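import Literature.Topology.FourManifolds.SliceKnotsProofs
import Literature.Topology.FourManifolds.SliceRibbonTopSliceProofs
import HarnessLib

/-!
# Fox–Milnor (smooth) is a one-line consequence of Fox–Milnor (topological): the assembly

Librarian fact-decomposition (libsplit-27, 2026-08-16) of the capped named fact
`Literature.Topology.FourManifolds.exists_eq_mul_invert_of_isSmoothlySlice` (**spc4.S26**, Fox–Milnor
1966, Thm. 2, smooth category; `SliceKnots.lean`). The printed proof (Fox–Milnor, pp. 262–263) uses
only a locally flat slice disc, so the smooth statement is the topological one
(`exists_eq_mul_invert_of_isTopologicallySlice`, same file) composed with "smoothly slice ⇒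
topologically slice" (`Knot.IsSmoothlySlice.isTopologicallySlice`, `SliceRibbon.lean`), which is now a
THEOREM of the tree (`Knot.IsSmoothlySlice.isTopologicallySlice_holds`,
`SliceRibbonTopSliceProofs.lean`; Freedman–Quinn 1990, §9.3; Kosinski 1993, Ch. III (4.2)). The
relative deduction `exists_eq_mul_invert_of_isTopologicallySlice.isSmoothlySlice` is in
`SliceKnotsProofs.lean`, which cannot import the discharge file (it predates it). This file records
the resulting split of the smooth fact into ONE child, the EXISTING topological named fact:

* `exists_eq_mul_invert_of_isSmoothlySlice_holds_of :
    exists_eq_mul_invert_of_isTopologicallySlice → exists_eq_mul_invert_of_isSmoothlySlice` (proved).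

So the debt of spc4.S26 is carried entirely by the topological fact (whose own reduction to the
geometric half — an Alexander-module presentation by a metabolic/isotropic matrix for topologically
slice knots — is `exists_eq_mul_invert_of_isTopologicallySlice_of_presentation`,
`…_of_isotropic_presentation`, `…_of_hnn_presentation`, `SliceKnotsFoxMilnor*.lean`). No definition,
no new named fact.

## References

* R. H. Fox, J. W. Milnor, *Singularities of 2-spheres in 4-space and cobordism of knots*, Osaka J.
  Math. 3 (1966) 257–267, §2 Thm. 2 (p. 262), proof pp. 262–263. [FoxMilnor1966]
* M. H. Freedman, F. Quinn, *Topology of 4-manifolds* (1990), §9.3. [FreedmanQuinn1990]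
-/

open scoped LaurentPolynomial

noncomputable section

namespace Literature.Topology.FourManifolds

/-- **Fox–Milnor for smoothly slice knots from Fox–Milnor for topologically slice knots** (the
assembly of the one-child split of `exists_eq_mul_invert_of_isSmoothlySlice`): since smoothly slice
knots are topologically slice (`Knot.IsSmoothlySlice.isTopologicallySlice_holds`, proved), the
topological Fox–Milnor condition `Δ = u · f · f(t⁻¹)` for topologically slice knots gives it for
smoothly slice knots. Fox–Milnor's printed proof is the topological (locally flat) one.
[cite: FoxMilnor1966, §2 Thm. 2, p. 262] -/
theorem exists_eq_mul_invert_of_isSmoothlySlice_holds_of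
    (h : exists_eq_mul_invert_of_isTopologicallySlice) :
    exists_eq_mul_invert_of_isSmoothlySlice :=
  h.isSmoothlySlice Knot.IsSmoothlySlice.isTopologicallySlice_holds

end Literature.Topology.FourManifolds

end
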